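import Summits.ResolutionOfSingularities.ResolutionOfSingularities.Theorems.FrobeniusClosingPatchingRelPerfectDepthMultiHostResidual
import Summits.ResolutionOfSingularities.ResolutionOfSingularities.Theorems.FrobeniusClosingPatchingRelPerfectDepthMultiHostEnd
import Literature.AlgebraicGeometry.Resolution.RegularSubschemeLocallyIrreducible
import Literature.AlgebraicGeometry.Resolution.BlowupSequences
import Literature.AlgebraicGeometry.Resolution.KollarSplitBoundary
import HarnessLib

/-!
# Crux `PatchingRelPerfect` (stmt-ResolutionOfSingularities-16161), chain W5.2 — F7(β) (β-AX) X3 C-I, (M1): THE MONOMIAL-PHASE MOVE IS LEGAL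
# (`…DepthPhaseCMonomialMove`)

[OURS · L1 W5.2 · F7(β) (β-AX) X3 C-I · res-L1-w52-plan-1 RULING G12-5 (M1) / NOTE G12-6 (2) / NAMING 19:06:13Z, hand res-D-repro-1 AS res-L1-repro-3]
LEGALITY ONLY (no choice rule, no termination — those are LEMMA M, res-L1-w52-idea-1): for a multi-host state `S` on a regular (locally
Noetherian) `X` and a family `𝓜` of MEMBERS which HITS the residual — every residual summand `host i · ∏_T T^{r_i(T)}` of `K♭ = S.residual.K`
keeps a member factor `T ∈ 𝓜` with `r_i(T) ≥ 1` (the exponent-level form of res-L1-w52-idea-1΄s `HasMemberHitAt`, Sketch v16 §3; exponents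
`exps` are GLOBAL state data, so a hit read at one point is a hit everywhere) — the snc STRATUM `W_𝓜 = V(Σ_{T ∈ 𝓜} T)` is a LEGAL C-I centre:
`K♭ ≤ Σ_{T ∈ 𝓜} T` globally (`residual_K_le_finsetSup`), hence `W_𝓜 ⊆ cosupp K♭ ⊆ cosupp K`; `W_𝓜` is a regular subscheme having simple
normal crossings with `S.𝓔` (tree `HasSNC.isRegular_subscheme_finsetSup` / `HasSNC.hasSNCWith_finsetSup`), also in the `vanishingIdeal`
currency `MultiHostState.step` consumes (`eq_vanishingIdeal_support_of_isRegular`); so the one-step centre sequence along `W_𝓜` is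
`AllRegular ∧ CentresOver (cosupp K♭)` (and `CentresOver (cosupp K)`); §3 does the same ONE PIECE (irreducible / connected component of
`W_𝓜`) at a time — `hasSNCWith_vanishingIdeal_piece`, `monomialMove_legal_piece`, `isPiecePartition_boundaryPieces_finsetSup` — the
irreducible centres whose generic points `MultiHostState.K_step` reads; §4: along the stratum every residual summand has positive weight
(`weightAt_residualExps_pos`), so the move with host orders `0` and weight `1` satisfies the hypotheses of `K_step`
(`K_step_hypotheses_of_hit`).  NOT a statement of the manuscript under review; AI-written, weaker
than expert review.  Mathlib + landed W5.2 files only; no definition, no fact, no sorry.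

## References
* J. Kollár, *Lectures on Resolution of Singularities* (2007), (3.111) Step 3 and Def. 3.25 (strata of an snc boundary as centres). [Kollar2007]
* E. Bierstone, D. Grigoriev, P. Milman, J. Włodarczyk, *Effective Hironaka resolution …* (2011), §4 Step 2 (the monomial / combinatorial
  phase: blowing up intersections of exceptional components inside the cosupport of the monomial part). [BierstoneGrigorievMilmanWlodarczyk2011]
-/

-- `Summit.<Summit>.<Sub>.Theorems` with `Sub = Summit` (single-conjunct summit, D-0017)
set_option linter.dupNamespace false

noncomputable section

open CategoryTheory AlgebraicGeometry TopologicalSpace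
open Literature.AlgebraicGeometry.Resolution
open Scheme.IdealSheafData

namespace Summit.ResolutionOfSingularities.ResolutionOfSingularities.Theorems.DepthMultiHost

universe u

variable {X : Scheme.{u}}

namespace MultiHostState

variable (S : MultiHostState X)

/-! ## §1 A hitting member family contains the residual -/

/-- A monomial is contained in each of its genuine factors: `∏ T^{e_T} ≤ T₀` when `(T₀, e) ∈ E` with `e ≠ 0`. [folklore] -/
theorem monomialIdeal_le_of_mem {E : List (X.IdealSheafData × ℕ)} {p : X.IdealSheafData × ℕ} (hp : p ∈ E) (he : p.2 ≠ 0) :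
    monomialIdeal E ≤ p.1 := by
  induction E with
  | nil => simp at hp
  | cons q E ih =>
    rw [monomialIdeal_cons]
    rcases List.mem_cons.mp hp with rfl | hpE
    · obtain ⟨k, hk⟩ := Nat.exists_eq_succ_of_ne_zero he
      rw [hk, pow_succ', mul_assoc]
      exact mul_le_of_le_one_right bot_le le_top
    · exact (mul_le_of_le_one_left bot_le le_top).trans (ih hpE)

/-- [OURS · L1 W5.2 · (M1)] **A HITTING member family contains the residual**: if every residual summand keeps a factor `T ∈ 𝓜` with
positive residual exponent, then `K♭ ≤ Σ_{T ∈ 𝓜} T` (globally — exponents are global). [cite: BierstoneGrigorievMilmanWlodarczyk2011, §4 Step 2] -/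
theorem residual_K_le_finsetSup (𝓜 : Finset X.IdealSheafData)
    (hhit : ∀ i : Fin S.n, ∃ p ∈ S.residualExps i, p.1 ∈ 𝓜 ∧ p.2 ≠ 0) :
    S.residual.K ≤ 𝓜.sup id := by
  refine iSup_le fun i => ?_
  obtain ⟨p, hp, hp𝓜, hp2⟩ := hhit i
  calc S.residual.host i * monomialIdeal (S.residual.exps i)
      ≤ monomialIdeal (S.residualExps i) := mul_le_of_le_one_left bot_le le_top
    _ ≤ p.1 := monomialIdeal_le_of_mem hp hp2
    _ ≤ 𝓜.sup id := Finset.le_sup (f := id) hp𝓜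

/-- [OURS · L1 W5.2 · (M1)] **The hitting stratum lies in the residual cosupport**: `V(Σ_{T ∈ 𝓜} T) ⊆ cosupp K♭`. [folklore] -/
theorem support_finsetSup_subset_residual (𝓜 : Finset X.IdealSheafData)
    (hhit : ∀ i : Fin S.n, ∃ p ∈ S.residualExps i, p.1 ∈ 𝓜 ∧ p.2 ≠ 0) :
    ((𝓜.sup id).support : Set X) ⊆ (S.residual.K.support : Set X) :=
  fun _ hx => support_antitone (S.residual_K_le_finsetSup 𝓜 hhit) hx

/-- [OURS · L1 W5.2 · (M1)] … and hence in `cosupp K`. [folklore] -/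
theorem support_finsetSup_subset_K (𝓜 : Finset X.IdealSheafData)
    (hhit : ∀ i : Fin S.n, ∃ p ∈ S.residualExps i, p.1 ∈ 𝓜 ∧ p.2 ≠ 0) :
    ((𝓜.sup id).support : Set X) ⊆ (S.K.support : Set X) :=
  (S.support_finsetSup_subset_residual 𝓜 hhit).trans S.residual_K_support_subset

/-- The stalk form at a point: a hitting family of members gives res-L1-w52-idea-1΄s stalk inequality `K♭_x ≤ Σ_{T ∈ 𝓜} T_x`
(Sketch v16 §3 `HasMemberHitAt`, for the sub-family `𝓜`). [folklore] -/
theorem stalkIdeal_residual_K_le (𝓜 : Finset X.IdealSheafData)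
    (hhit : ∀ i : Fin S.n, ∃ p ∈ S.residualExps i, p.1 ∈ 𝓜 ∧ p.2 ≠ 0) (x : X) :
    stalkIdeal S.residual.K x ≤ 𝓜.sup fun T => stalkIdeal T x := by
  rw [← stalkIdeal_finsetSup]
  exact stalkIdeal_mono (S.residual_K_le_finsetSup 𝓜 hhit) x

/-! ## §2 The hitting stratum is a legal centre -/

/-- [OURS · L1 W5.2 · (M1)] **A member stratum has simple normal crossings with the member family.** [cite: Kollar2007, Def. 3.25] -/
theorem hasSNCWith_finsetSup (𝓜 : Finset X.IdealSheafData) (h𝓜 : ∀ T ∈ 𝓜, T ∈ S.𝓔) : HasSNCWith S.𝓔 (𝓜.sup id) :=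
  HasSNC.hasSNCWith_finsetSup S.snc 𝓜 h𝓜

/-- The residual has the same members, so the same strata are snc with its family. [folklore] -/
theorem hasSNCWith_residual_iff (C : X.IdealSheafData) : HasSNCWith S.residual.𝓔 C ↔ HasSNCWith S.𝓔 C :=
  Iff.rfl

variable [IsLocallyNoetherian X]

/-- [OURS · L1 W5.2 · (M1)] **A member stratum is a regular subscheme.** [cite: Kollar2007, (3.111) Step 3] -/
theorem isRegular_subscheme_finsetSup (𝓜 : Finset X.IdealSheafData) (h𝓜 : ∀ T ∈ 𝓜, T ∈ S.𝓔) :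
    Scheme.IsRegular (𝓜.sup id).subscheme :=
  HasSNC.isRegular_subscheme_finsetSup S.snc 𝓜 h𝓜

/-- [OURS · L1 W5.2 · (M1)] The stratum ideal is the vanishing ideal of its support (regular ⇒ reduced) — the currency of
`MultiHostState.step` (`vanishingIdeal W`). [cite: StacksProject, Tag 01J3] -/
theorem finsetSup_eq_vanishingIdeal (𝓜 : Finset X.IdealSheafData) (h𝓜 : ∀ T ∈ 𝓜, T ∈ S.𝓔) :
    𝓜.sup id = vanishingIdeal (𝓜.sup id).support :=
  eq_vanishingIdeal_support_of_isRegular _ (S.isRegular_subscheme_finsetSup 𝓜 h𝓜)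

/-- [OURS · L1 W5.2 · (M1)] **`HasSNCWith S.𝓔 (vanishingIdeal W_𝓜)`** — the hypothesis `hsnc` of `MultiHostState.step` along the stratum.
[cite: Kollar2007, Def. 3.25] -/
theorem hasSNCWith_vanishingIdeal_finsetSup (𝓜 : Finset X.IdealSheafData) (h𝓜 : ∀ T ∈ 𝓜, T ∈ S.𝓔) :
    HasSNCWith S.𝓔 (vanishingIdeal (𝓜.sup id).support) := by
  rw [← S.finsetSup_eq_vanishingIdeal 𝓜 h𝓜]
  exact S.hasSNCWith_finsetSup 𝓜 h𝓜

/-- [OURS · L1 W5.2 · (M1)] **THE MONOMIAL-PHASE MOVE IS LEGAL**: for a hitting member family `𝓜 ⊆ S.𝓔`, the one-step centre sequence along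
the stratum `W_𝓜 = V(Σ_{T ∈ 𝓜} T)` has a regular centre lying over `cosupp K♭` — and over `cosupp K`. (No choice rule, no termination.)
[cite: Kollar2007, (3.111) Step 3] [cite: BierstoneGrigorievMilmanWlodarczyk2011, §4 Step 2] -/
theorem monomialMove_legal (𝓜 : Finset X.IdealSheafData) (h𝓜 : ∀ T ∈ 𝓜, T ∈ S.𝓔)
    (hhit : ∀ i : Fin S.n, ∃ p ∈ S.residualExps i, p.1 ∈ 𝓜 ∧ p.2 ≠ 0) :
    (CentreSeq.cons (𝓜.sup id) (CentreSeq.nil _)).AllRegular ∧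
      (CentreSeq.cons (𝓜.sup id) (CentreSeq.nil _)).CentresOver (S.residual.K.support : Set X) ∧
      (CentreSeq.cons (𝓜.sup id) (CentreSeq.nil _)).CentresOver (S.K.support : Set X) :=
  ⟨⟨S.isRegular_subscheme_finsetSup 𝓜 h𝓜, trivial⟩, ⟨S.support_finsetSup_subset_residual 𝓜 hhit, trivial⟩,
    ⟨S.support_finsetSup_subset_K 𝓜 hhit, trivial⟩⟩

/-! ## §3 One COMPONENT at a time: the pieces of the hitting stratum are legal, irreducible centres

`MultiHostState.step` / `K_step` read exponents at the generic point of an IRREDUCIBLE centre; the stratum `W_𝓜` splits into its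
pieces (pairwise disjoint closed pieces covering `V(Σ𝓜)`, e.g. its irreducible = connected components `Kollar2007.boundaryPieces`), and
each piece is a legal centre with the same local equations. -/

/-- [OURS · L1 W5.2 · (M1)] **A piece of a member stratum has simple normal crossings with the member family** (near a point of the
piece the piece IS the stratum, so the stalks of `𝓘(Z)` and of `Σ_{T ∈ 𝓜} T` agree). [cite: Kollar2007, Def. 3.25]
[cite: BierstoneGrigorievMilmanWlodarczyk2011, §4 Step 2] -/
theorem hasSNCWith_vanishingIdeal_piece (𝓜 : Finset X.IdealSheafData) (h𝓜 : ∀ T ∈ 𝓜, T ∈ S.𝓔) {Zs : List (Closeds X)}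
    (hZs : IsPiecePartition (𝓜.sup id) Zs) {Z : Closeds X} (hZ : Z ∈ Zs) : HasSNCWith S.𝓔 (vanishingIdeal Z) := by
  intro x
  obtain ⟨hreg, u, hu, hmem, hC⟩ := S.hasSNCWith_finsetSup 𝓜 h𝓜 x
  refine ⟨hreg, u, hu, hmem, fun hx => ?_⟩
  have hxZ : x ∈ (Z : Set X) := by
    rw [← Scheme.IdealSheafData.coe_support_vanishingIdeal Z]
    exact hx
  obtain ⟨U, hxU, hU⟩ := hZs.exists_nhd hZ hxZ
  obtain ⟨T, hT⟩ := hC (hZs.subset hZ hxZ)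
  refine ⟨T, ?_⟩
  rw [stalkIdeal_vanishingIdeal_congr (Z' := (𝓜.sup id).support) U hxU hU, ← S.finsetSup_eq_vanishingIdeal 𝓜 h𝓜]
  exact hT

/-- [OURS · L1 W5.2 · (M1)] A piece of a member stratum is a regular subscheme. [cite: Kollar2007, (3.111) Step 3] -/
theorem isRegular_subscheme_vanishingIdeal_piece (𝓜 : Finset X.IdealSheafData) (h𝓜 : ∀ T ∈ 𝓜, T ∈ S.𝓔) {Zs : List (Closeds X)}
    (hZs : IsPiecePartition (𝓜.sup id) Zs) {Z : Closeds X} (hZ : Z ∈ Zs) : Scheme.IsRegular (vanishingIdeal Z).subscheme :=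
  (S.hasSNCWith_vanishingIdeal_piece 𝓜 h𝓜 hZs hZ).isRegular_subscheme

omit [IsLocallyNoetherian X] in
/-- [OURS · L1 W5.2 · (M1)] A piece of a hitting stratum lies in `cosupp K♭`. [folklore] -/
theorem piece_subset_residual (𝓜 : Finset X.IdealSheafData) (hhit : ∀ i : Fin S.n, ∃ p ∈ S.residualExps i, p.1 ∈ 𝓜 ∧ p.2 ≠ 0)
    {Zs : List (Closeds X)} (hZs : IsPiecePartition (𝓜.sup id) Zs) {Z : Closeds X} (hZ : Z ∈ Zs) :
    (Z : Set X) ⊆ (S.residual.K.support : Set X) :=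
  (hZs.subset hZ).trans (S.support_finsetSup_subset_residual 𝓜 hhit)

/-- [OURS · L1 W5.2 · (M1)] **THE MONOMIAL-PHASE MOVE ALONG ONE PIECE IS LEGAL**: the one-step centre sequence along a piece `Z` of the
hitting stratum (centre `𝓘(Z)`) has a regular centre over `cosupp K♭` and over `cosupp K`. [cite: Kollar2007, (3.111) Step 3]
[cite: BierstoneGrigorievMilmanWlodarczyk2011, §4 Step 2] -/
theorem monomialMove_legal_piece (𝓜 : Finset X.IdealSheafData) (h𝓜 : ∀ T ∈ 𝓜, T ∈ S.𝓔)
    (hhit : ∀ i : Fin S.n, ∃ p ∈ S.residualExps i, p.1 ∈ 𝓜 ∧ p.2 ≠ 0)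
    {Zs : List (Closeds X)} (hZs : IsPiecePartition (𝓜.sup id) Zs) {Z : Closeds X} (hZ : Z ∈ Zs) :
    (CentreSeq.cons (vanishingIdeal Z) (CentreSeq.nil _)).AllRegular ∧
      (CentreSeq.cons (vanishingIdeal Z) (CentreSeq.nil _)).CentresOver (S.residual.K.support : Set X) ∧
      (CentreSeq.cons (vanishingIdeal Z) (CentreSeq.nil _)).CentresOver (S.K.support : Set X) := by
  have h1 : ((vanishingIdeal Z).support : Set X) ⊆ (S.residual.K.support : Set X) := by
    rw [Scheme.IdealSheafData.coe_support_vanishingIdeal]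
    exact S.piece_subset_residual 𝓜 hhit hZs hZ
  exact ⟨⟨S.isRegular_subscheme_vanishingIdeal_piece 𝓜 h𝓜 hZs hZ, trivial⟩, ⟨h1, trivial⟩,
    ⟨h1.trans S.residual_K_support_subset, trivial⟩⟩

/-- [OURS · L1 W5.2 · (M1)] **The irreducible components of the hitting stratum are such pieces** (Noetherian `X`): they partition
`V(Σ𝓜)` (`Kollar2007.isPiecePartition_boundaryPieces`), and each is irreducible — so it has a generic point at which `K_step` reads the
exponents. [cite: BierstoneGrigorievMilmanWlodarczyk2011, §4 Step 2 (p. 12)] -/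
theorem isPiecePartition_boundaryPieces_finsetSup [NoetherianSpace X] (𝓜 : Finset X.IdealSheafData) (h𝓜 : ∀ T ∈ 𝓜, T ∈ S.𝓔) :
    IsPiecePartition (𝓜.sup id) (Kollar2007.boundaryPieces (𝓜.sup id)) ∧
      ∀ Z ∈ Kollar2007.boundaryPieces (𝓜.sup id), IsIrreducible (Z : Set X) :=
  ⟨Kollar2007.isPiecePartition_boundaryPieces (S.hasSNCWith_finsetSup 𝓜 h𝓜),
    fun _ hZ => componentsIn.isIrreducible (Kollar2007.mem_boundaryPieces_iff.mp hZ)⟩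

/-! ## §4 The weight along the hitting stratum is positive: the `K_step` hypotheses of a move with host orders `0` -/

omit [IsLocallyNoetherian X] in
/-- A member through `x` contributes its exponent to the weight at `x`. [folklore] -/
theorem le_weightAt_of_mem {E : List (X.IdealSheafData × ℕ)} {p : X.IdealSheafData × ℕ} (hp : p ∈ E) {x : X}
    (hx : x ∈ p.1.support) : p.2 ≤ weightAt E x := by
  induction E with
  | nil => simp at hp
  | cons q E ih =>
    rw [weightAt_cons]
    rcases List.mem_cons.mp hp with rfl | hpE
    · rw [if_pos hx]
      exact Nat.le_add_right _ _
    · exact (ih hpE).trans (Nat.le_add_left _ _)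

omit [IsLocallyNoetherian X] in
/-- [OURS · L1 W5.2 · (M1)] **Along the hitting stratum every residual summand has positive weight** (`Σ_{T ∋ x} r_i(T) ≥ 1`), so any
weight `ν ≤ min_i Σ_{T ∋ η} r_i(T)` — in particular `ν = 1` — is admissible in `MultiHostState.K_step` with host orders `0`.
[cite: BierstoneGrigorievMilmanWlodarczyk2011, §4 Step 2] -/
theorem weightAt_residualExps_pos (𝓜 : Finset X.IdealSheafData)
    (hhit : ∀ i : Fin S.n, ∃ p ∈ S.residualExps i, p.1 ∈ 𝓜 ∧ p.2 ≠ 0) {x : X} (hx : x ∈ ((𝓜.sup id).support : Set X))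
    (i : Fin S.n) : 0 < weightAt (S.residualExps i) x := by
  obtain ⟨p, hp, hp𝓜, hp2⟩ := hhit i
  have hxp : x ∈ p.1.support := (mem_support_finsetSup_iff 𝓜 x).mp hx p.1 hp𝓜
  exact (Nat.pos_of_ne_zero hp2).trans_le (le_weightAt_of_mem hp hxp)

omit [IsLocallyNoetherian X] in
/-- [OURS · L1 W5.2 · (M1)] **The `K_step` hypotheses of the move** along any closed `W` inside the hitting stratum, read at any point
`η ∈ W` (e.g. the generic point of a piece): host orders `m = 0` (`host i ≤ 𝓘_W ^ 0`) and weight `ν = 1 ≤ 0 + weightAt (exps♭ i) η`.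
[cite: Kollar2007, (3.111) Steps 1–3] -/
theorem K_step_hypotheses_of_hit (𝓜 : Finset X.IdealSheafData)
    (hhit : ∀ i : Fin S.n, ∃ p ∈ S.residualExps i, p.1 ∈ 𝓜 ∧ p.2 ≠ 0) (W : Closeds X)
    (hW : (W : Set X) ⊆ ((𝓜.sup id).support : Set X)) {η : X} (hη : η ∈ (W : Set X)) :
    (∀ i : Fin S.residual.n, S.residual.host i ≤ vanishingIdeal W ^ (0 : ℕ)) ∧
      ∀ i : Fin S.residual.n, 1 ≤ 0 + weightAt (S.residual.exps i) η :=
  ⟨fun i => S.residual.host_le_pow_zero W i, fun i => by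
    rw [zero_add]
    exact S.weightAt_residualExps_pos 𝓜 hhit (hW hη) i⟩

end MultiHostState

end Summit.ResolutionOfSingularities.ResolutionOfSingularities.Theorems.DepthMultiHost

end
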